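import Mathlib
import HarnessLib

/-!
# The signed principal-unit lattice of a family of primes

Cell topic `Summits/ABC/StewartYu` (cell abc-stewartyu, HOME `run/shared/lean/pub/abc-stewartyu/`, seat p1); namespace
`Summit.ABC.StewartYu.PrincipalLattice`.

For a prime `p` and natural numbers `q₁, …, q_m` prime to `p` (in the application: distinct primes
`≠ p`), the **signed principal-unit lattice** is
`Λ^± = {z ∈ ℤ^m : ∏ q̄ᵢ^{zᵢ} = ±1 in (ℤ/p)ˣ}`,
the preimage of `{±1}` under the exponent homomorphism `ψ : ℤ^m → (ℤ/p)ˣ`, `ψ(z) = ∏ q̄ᵢ^{zᵢ}`.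
It has index `[ℤ^m : Λ^±] ≤ #(ℤ/p)ˣ = p − 1` (`index_latPM_le`). To `z ∈ Λ^±` one attaches the
**sign-normalised generator** `α̃(z) = χ(z) · ∏ qᵢ^{zᵢ} ∈ ℚ` with the sign `χ(z) ∈ {±1}` chosen so
that `χ(z) ≡ ∏ q̄ᵢ^{zᵢ} (mod p)` (`unitSign`, `signedProd`, `cast_unitSign_eq`); then
`α̃(z) ≡ 1 (mod p)` is a principal unit of `ℚ_p` whose height is `∑ |zᵢ| log qᵢ` — the price of
principalisation is the index `≤ p − 1` of the lattice, paid ONCE, instead of the factor `(p−1)^m`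
of the naive `qᵢ ↦ qᵢ^{p−1}`.

This file only sets up the objects (definitions + their immediate API). The arithmetic of the
generators attached to a `ℤ`-basis of `Λ^±` — congruences, multiplicative independence, the Kummer
condition "no sub-product is a square" (automatic for a BASIS of `Λ^±`), heights — is in
`Summits/ABC/StewartYu/PrincipalUnitLatticeKummer.lean`, and the geometry-of-numbers reduction (a basis with small
heights product, by Minkowski's second theorem and Mahler's basis theorem) in
`Summits/ABC/StewartYu/PadicLogFormsPrincipalReduction.lean`. Together they form work package WP-M ("reduction to signed
principal-unit generators, Kummer condition for free") of the kernel `p`-adic Baker bound for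
logarithms of rational primes (the `p`-adic input of the Stewart–Yu / Stewart–Tijdeman abc bounds,
`Literature/Barriers/ABC/BakerMethodBounds*.lean`); compare the unsigned level-`m₀` lattice of
`Literature.Barriers.ABC.StewartTijdemanPrincipal.exists_principal_lattice`, which yields positive
but not Kummer-free generators.

Design notes. `ψ` is written additively (`ℤ^m →+ Additive (ℤ/p)ˣ`) so that `Λ^±` is an
`AddSubgroup` (`latPM`) and a `ℤ`-submodule (`latPMSub`) of `ℤ^m = Fin m → ℤ`; the residues `q̄ᵢ`
are units via `Units.mk0` under `[Fact p.Prime]` and the hypothesis `(qᵢ : ℤ/p) ≠ 0`. Everything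
here is elementary and [folklore]; no named facts are introduced.
-/

noncomputable section

open Finset

namespace Summit.ABC.StewartYu.PrincipalLattice

variable {m : ℕ} {p : ℕ} [hp : Fact p.Prime]

/-! ### The exponent homomorphism and the lattice `Λ^±` -/

/-- The residue `q̄ᵢ ∈ (ℤ/p)ˣ` of a natural number prime to `p`, as a unit (`Units.mk0` in the
field `ℤ/p`). [folklore] -/
def resUnit (q : Fin m → ℕ) (hq0 : ∀ i, ((q i : ℕ) : ZMod p) ≠ 0) (i : Fin m) : (ZMod p)ˣ :=
  Units.mk0 ((q i : ℕ) : ZMod p) (hq0 i)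

/-- The exponent homomorphism `ψ : ℤ^m → (ℤ/p)ˣ` (written additively), `ψ(z) = ∏ q̄ᵢ^{zᵢ}`.
[folklore] -/
def expHom (q : Fin m → ℕ) (hq0 : ∀ i, ((q i : ℕ) : ZMod p) ≠ 0) :
    (Fin m → ℤ) →+ Additive (ZMod p)ˣ :=
  ∑ i : Fin m, (zmultiplesHom (Additive (ZMod p)ˣ) (Additive.ofMul (resUnit q hq0 i))).comp
    (Pi.evalAddMonoidHom (fun _ : Fin m => ℤ) i)

/-- `ψ(z) = ∑ zᵢ • q̄ᵢ` (additive notation). [folklore] -/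
theorem expHom_apply (q : Fin m → ℕ) (hq0 : ∀ i, ((q i : ℕ) : ZMod p) ≠ 0) (z : Fin m → ℤ) :
    expHom q hq0 z = ∑ i, z i • Additive.ofMul (resUnit q hq0 i) := by
  simp [expHom]

/-- `ψ(z) = ∏ q̄ᵢ^{zᵢ}` (multiplicative notation). [folklore] -/
theorem toMul_expHom (q : Fin m → ℕ) (hq0 : ∀ i, ((q i : ℕ) : ZMod p) ≠ 0) (z : Fin m → ℤ) :
    Additive.toMul (expHom q hq0 z) = ∏ i, resUnit q hq0 i ^ z i := by
  rw [expHom_apply]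
  simp [toMul_sum, toMul_zsmul]

/-- The sign subgroup `{±1} = ℤ ∙ (−1)` of `(ℤ/p)ˣ` (additive notation). [folklore] -/
def signSub (p : ℕ) [Fact p.Prime] : AddSubgroup (Additive (ZMod p)ˣ) :=
  AddSubgroup.zmultiples (Additive.ofMul (-1))

/-- Membership in the sign subgroup: `x ∈ {±1} ↔ x = 1 ∨ x = −1`. [folklore] -/
theorem mem_signSub_iff {x : Additive (ZMod p)ˣ} :
    x ∈ signSub p ↔ Additive.toMul x = 1 ∨ Additive.toMul x = -1 := by
  rw [signSub, AddSubgroup.mem_zmultiples_iff]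
  constructor
  · rintro ⟨k, hk⟩
    rw [← hk, toMul_zsmul, toMul_ofMul]
    rcases Int.even_or_odd k with ⟨j, rfl⟩ | ⟨j, rfl⟩
    · left
      rw [← two_mul, zpow_mul, zpow_two, neg_one_mul, neg_neg, one_zpow]
    · right
      rw [zpow_add, zpow_mul, zpow_two, neg_one_mul, neg_neg, one_zpow, zpow_one, one_mul]
  · rintro (h | h)
    · refine ⟨0, ?_⟩
      apply Additive.toMul.injective
      rw [toMul_zsmul, toMul_ofMul, zpow_zero, h]
    · refine ⟨1, ?_⟩
      apply Additive.toMul.injective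
      rw [toMul_zsmul, toMul_ofMul, zpow_one, h]

/-- **The signed principal-unit lattice** `Λ^± = {z ∈ ℤ^m : ∏ q̄ᵢ^{zᵢ} = ±1 in ℤ/p}`. [folklore] -/
def latPM (q : Fin m → ℕ) (hq0 : ∀ i, ((q i : ℕ) : ZMod p) ≠ 0) : AddSubgroup (Fin m → ℤ) :=
  (signSub p).comap (expHom q hq0)

/-- Membership in `Λ^±`: `z ∈ Λ^± ↔ ∏ q̄ᵢ^{zᵢ} = 1 ∨ ∏ q̄ᵢ^{zᵢ} = −1`. [folklore] -/
theorem mem_latPM_iff (q : Fin m → ℕ) (hq0 : ∀ i, ((q i : ℕ) : ZMod p) ≠ 0) (z : Fin m → ℤ) :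
    z ∈ latPM q hq0 ↔ (∏ i, resUnit q hq0 i ^ z i = 1 ∨ ∏ i, resUnit q hq0 i ^ z i = -1) := by
  rw [latPM, AddSubgroup.mem_comap, mem_signSub_iff, toMul_expHom]

/-- `ker ψ ≤ Λ^±`. [folklore] -/
theorem ker_le_latPM (q : Fin m → ℕ) (hq0 : ∀ i, ((q i : ℕ) : ZMod p) ≠ 0) :
    (expHom q hq0).ker ≤ latPM q hq0 := by
  intro z hz
  rw [AddMonoidHom.mem_ker] at hz
  rw [latPM, AddSubgroup.mem_comap, hz]
  exact zero_mem _

/-- **The index of `Λ^±` is at most `p − 1`** (`[ℤ^m : Λ^±] ≤ [ℤ^m : ker ψ] = #ψ(ℤ^m) ≤ #(ℤ/p)ˣ`).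
[folklore] -/
theorem index_latPM_le (q : Fin m → ℕ) (hq0 : ∀ i, ((q i : ℕ) : ZMod p) ≠ 0) :
    (latPM q hq0).index ≤ p - 1 ∧ 0 < (latPM q hq0).index := by
  have hker : (expHom q hq0).ker.index = Nat.card (expHom q hq0).range :=
    AddSubgroup.index_ker (expHom q hq0)
  have hfin : Finite (Additive (ZMod p)ˣ) := by
    change Finite (ZMod p)ˣ; infer_instance
  have hcardR : Nat.card (expHom q hq0).range ≤ p - 1 := by
    calc Nat.card (expHom q hq0).range ≤ Nat.card (Additive (ZMod p)ˣ) :=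
          Nat.card_le_card_of_injective _ Subtype.val_injective
      _ = p - 1 := by
          change Nat.card (ZMod p)ˣ = p - 1
          rw [Nat.card_eq_fintype_card, ZMod.card_units_eq_totient, Nat.totient_prime hp.out]
  have hkerpos : 0 < (expHom q hq0).ker.index := by
    rw [hker]; exact Nat.card_pos
  have hdvd : (latPM q hq0).index ∣ (expHom q hq0).ker.index :=
    AddSubgroup.index_dvd_of_le (ker_le_latPM q hq0)
  refine ⟨(Nat.le_of_dvd hkerpos hdvd).trans (hker ▸ hcardR), ?_⟩
  exact Nat.pos_of_ne_zero fun h0 => by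
    rw [h0] at hdvd; exact absurd (Nat.eq_zero_of_zero_dvd hdvd) hkerpos.ne'

/-! ### `Λ^±` as a `ℤ`-submodule of `ℤ^m` -/

/-- `Λ^±` as a `ℤ`-submodule of `ℤ^m`. [folklore] -/
def latPMSub (q : Fin m → ℕ) (hq0 : ∀ i, ((q i : ℕ) : ZMod p) ≠ 0) : Submodule ℤ (Fin m → ℤ) :=
  (latPM q hq0).toIntSubmodule

/-- The `ℤ`-submodule `Λ^±` has the same elements as the subgroup `Λ^±`. [folklore] -/
theorem mem_latPMSub_iff (q : Fin m → ℕ) (hq0 : ∀ i, ((q i : ℕ) : ZMod p) ≠ 0) (z : Fin m → ℤ) :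
    z ∈ latPMSub q hq0 ↔ z ∈ latPM q hq0 := Iff.rfl

/-! ### Sign normalisation: `α̃(z) = χ(z) · ∏ qᵢ^{zᵢ} ≡ 1 (mod p)` -/

/-- The sign `χ(z) ∈ {1, −1}` normalising `∏ qᵢ^{zᵢ}` to a principal unit: `χ(z) = 1` if
`∏ q̄ᵢ^{zᵢ} = 1` in `(ℤ/p)ˣ` and `χ(z) = −1` otherwise (so that `χ(z) ≡ ∏ q̄ᵢ^{zᵢ}` for
`z ∈ Λ^±`). [folklore] -/
def unitSign (q : Fin m → ℕ) (hq0 : ∀ i, ((q i : ℕ) : ZMod p) ≠ 0) (z : Fin m → ℤ) : ℤ :=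
  if Additive.toMul (expHom q hq0 z) = 1 then 1 else -1

/-- **The sign-normalised generator** `α̃(z) = χ(z) · ∏ qᵢ^{zᵢ} ∈ ℚ` attached to an exponent
vector `z` (for `z ∈ Λ^±` it is `≡ 1 (mod p)`, `one_le_padicValRat_signedProd_sub_one`).
[folklore] -/
def signedProd (q : Fin m → ℕ) (hq0 : ∀ i, ((q i : ℕ) : ZMod p) ≠ 0) (z : Fin m → ℤ) : ℚ :=
  (unitSign q hq0 z : ℚ) * ∏ i, (q i : ℚ) ^ z i

/-- `χ(z) = ±1`. [folklore] -/
theorem unitSign_eq_or (q : Fin m → ℕ) (hq0 : ∀ i, ((q i : ℕ) : ZMod p) ≠ 0) (z : Fin m → ℤ) :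
    unitSign q hq0 z = 1 ∨ unitSign q hq0 z = -1 := by
  unfold unitSign; split_ifs <;> simp

/-- For `z ∈ Λ^±`, `χ(z) = ∏ q̄ᵢ^{zᵢ}` in `ℤ/p`. [folklore] -/
theorem cast_unitSign_eq (q : Fin m → ℕ) (hq0 : ∀ i, ((q i : ℕ) : ZMod p) ≠ 0)
    {z : Fin m → ℤ} (hz : z ∈ latPM q hq0) :
    ((unitSign q hq0 z : ℤ) : ZMod p) =
      ((Additive.toMul (expHom q hq0 z) : (ZMod p)ˣ) : ZMod p) := by
  rw [mem_latPM_iff] at hz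
  unfold unitSign
  rw [toMul_expHom]
  by_cases h1 : ∏ i, resUnit q hq0 i ^ z i = 1
  · rw [if_pos h1, h1]; push_cast; rfl
  · rw [if_neg h1]
    rcases hz with h | h
    · exact absurd h h1
    · rw [h, Units.val_neg, Units.val_one]; push_cast; rfl

/-- For `z ∈ Λ^±`, `(∏ q̄ᵢ^{zᵢ})² = 1` in `ℤ/p`. [folklore] -/
theorem val_toMul_expHom_sq (q : Fin m → ℕ) (hq0 : ∀ i, ((q i : ℕ) : ZMod p) ≠ 0)
    {z : Fin m → ℤ} (hz : z ∈ latPM q hq0) :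
    ((Additive.toMul (expHom q hq0 z) : (ZMod p)ˣ) : ZMod p) ^ 2 = 1 := by
  rw [mem_latPM_iff] at hz
  rw [toMul_expHom]
  rcases hz with h | h <;> rw [h] <;> simp

/-- Reduction of numerator and denominator: in `ℤ/p`,
`(∏ q̄ᵢ^{zᵢ}) · ∏ qᵢ^{zᵢ⁻} = ∏ qᵢ^{zᵢ⁺}`. [folklore] -/
theorem val_toMul_expHom_mul_den (q : Fin m → ℕ) (hq0 : ∀ i, ((q i : ℕ) : ZMod p) ≠ 0)
    (z : Fin m → ℤ) :
    ((Additive.toMul (expHom q hq0 z) : (ZMod p)ˣ) : ZMod p) *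
        ((∏ i, q i ^ (-z i).toNat : ℕ) : ZMod p) = ((∏ i, q i ^ (z i).toNat : ℕ) : ZMod p) := by
  rw [toMul_expHom]
  have h1 : (∏ i, resUnit q hq0 i ^ z i) * (∏ i, resUnit q hq0 i ^ (-z i).toNat) =
      ∏ i, resUnit q hq0 i ^ (z i).toNat := by
    rw [← Finset.prod_mul_distrib]
    refine Finset.prod_congr rfl fun i _ => ?_
    rw [← zpow_natCast, ← zpow_natCast, ← zpow_add]
    congr 1
    have := Int.toNat_sub_toNat_neg (z i)
    omega
  have h2 := congrArg (fun u : (ZMod p)ˣ => (u : ZMod p)) h1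
  simp only [Units.val_mul, Units.coe_prod, Units.val_pow_eq_pow_val,
    Units.val_zpow_eq_zpow_val] at h2
  have h3 : ∀ (i : Fin m) (n : ℕ), ((resUnit q hq0 i : (ZMod p)ˣ) : ZMod p) ^ n
      = ((q i : ℕ) : ZMod p) ^ n := fun i n => by rw [resUnit, Units.val_mk0]
  simp only [h3] at h2
  push_cast
  exact h2

/-- `α̃(z) ≠ 0`. [folklore] -/
theorem signedProd_ne_zero (q : Fin m → ℕ) (hq : ∀ i, (q i).Prime)
    (hq0 : ∀ i, ((q i : ℕ) : ZMod p) ≠ 0) (z : Fin m → ℤ) : signedProd q hq0 z ≠ 0 := by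
  unfold signedProd
  refine mul_ne_zero ?_ (Finset.prod_ne_zero_iff.mpr fun i _ =>
    zpow_ne_zero _ (by exact_mod_cast (hq i).ne_zero))
  rcases unitSign_eq_or q hq0 z with h | h <;> rw [h] <;> norm_num

end Summit.ABC.StewartYu.PrincipalLattice

end
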